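import Summits.QuantumFields.YangMills.Theorems.BalabanUVNodesN15FullPropagatorV1XCovTwoSidedNode
import HarnessLib

/-!
# THE COVARIANT ENTRIES 1 AND 3 OF `fgFamilyV1XC` IN THE REGULARITY WINDOW: the reading bridge and ★★★ `covEntries_torus_eq` — FILE 35 §3's per-lattice identifications composed with
# FILE 32's hypothesis-free Neumann-unit window (dag-n15-c g10, FILE 35b; Track-A node N15 = NE2, s1 «background-layer OPERATOR ingredient»)

`--kind proof --supports stmt-QuantumFields-20544 --as helper` (K3⁷; count-neutral).  Imports BY NAME this seat's FILE 35 `…FullPropagatorV1XCovTwoSidedNode` (`fgFamilyV1XC`,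
`covD_dressed_eq_covEntry1_torus`, `covLapM_dressed_eq_covEntry3_torus`; through it FILE 34 `bgOpsM₂RC` ∕ `bgFamilyM₂RC`, FILE 33 `covEntry1` ∕ `covEntry3`, FILE 32 ★★ `isUnit_neumann_torus_window`,
FILE 30 `v1cfgFX` ∕ `v1cfgCX`, FILE 28 `gaugeTransport` ∕ `covLapM`, n15-b `covD` ∕ `opFamily`); nothing in the tree is modified.

WHY (referee ref-J g9 READ-176, pub-ymgap INBOX l.25372, 2026-08-28): FILE 35's header announced a window-level theorem `covEntries_torus_eq` while its §3 proved the two identifications PER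
LATTICE, CONDITIONAL on the displayed Neumann unit `hunit`.  This file supplies the announced theorem: FILE 32's window theorem gives `hunit` at both lattices for every regular `A′`, and the
reading bridge `fgFamilyV1XC_eq_opFamily` (`rfl`) says which operators the family's kernels read.

WHAT.  `bgOpsM₂RC_one` ∕ `bgOpsM₂RC_three` (entries 1 ∕ 3 of FILE 34's operator four-tuple = `𝔇` of the fine ∕ coarse `covEntry1` ∕ `covEntry3`, `rfl`), `fgFamilyV1XC_eq_opFamily` (the family IS
`opFamily` of that four-tuple at the exact readings, `rfl`), ★★★ **`covEntries_torus_eq`**: `∃ a₀ > 0, ∀ i, ∀ α₀ ∈ (0, a₀∕M], ∀ A′` regular at `(c₃₅, α₀)`, ENTRY 1 of the four-tuple at `A′`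
`= 𝔇(∇_{exp(η′ ad A′_ν),τ′_ν} ∘ X′(A′), ∇_{exp(η ad Ā_ν),τ_ν} ∘ X(Ā))` and ENTRY 3 `= 𝔇(Δ_{exp(η′ ad A′)} ∘ X′(A′), Δ_{exp(η ad Ā)} ∘ X(Ā))`, `Ā = gavgM π A′`, `η′ = (L^mL^k)⁻¹`, `η = (L^k)⁻¹`
— NO unit hypothesis left.

HONEST FRAMING.  Composition∕bookkeeping (no new estimate); model-level items exactly as FILE 35 (flat base point `U ≡ 1` of the dressing; `DRD*` ∕ `aQ*Q` at `U ≡ 1`; C² reading of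
(3.35)–(3.36) in one global gauge; `𝔤 ↦ 𝔄` with coordinates; linearised block-mean transport).  NE2⁺ as printed NOT PRINTED; count-neutral; N15 NOT discharged; one finite torus at fixed
ε — NOT ℝ⁴, NOT infinite volume, NOT OS, NOT a mass gap, NOT Clay.
-/

noncomputable section

open scoped BigOperators
open Finset

namespace Summit.QuantumFields.YangMills.BalabanUVNodes.N15.BackgroundLayer

open scoped BigOperators
open Finset
open Literature.MathematicalPhysics.QuantumFieldTheory.Balaban1983to89
open Literature.MathematicalPhysics.QuantumFieldTheory.Balaban1983to89.B11SectG (BlockNorm HasMaj RowSum)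
open Literature.MathematicalPhysics.QuantumFieldTheory.Balaban1983to89.T4EtaRate (PairedInstance NE2PlusOperator rateFactor)
open Literature.MathematicalPhysics.QuantumFieldTheory.Balaban1983to89.T4EtaRateDefect (idef idef_apply rateWeight)
open Literature.MathematicalPhysics.QuantumFieldTheory.Balaban1983to89.T4EtaRateCoeffDefect (pull pull_apply diagK diagK_nonneg)
open Literature.MathematicalPhysics.QuantumFieldTheory.Balaban1983to89.B5Prop11Plancherel (Tor fine unitVec)
open Literature.MathematicalPhysics.QuantumFieldTheory.Balaban1983to89.B5SiteBridgeP12 (MP)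
open Literature.MathematicalPhysics.QuantumFieldTheory.Balaban1983to89.B6UnitTorusCarrier (unitTorusGeo triangle254_unitTorusGeo rowSum_unitTorusGeo unitTorusGeo_dist_nonneg
  unitTorusGeo_len)
open Literature.MathematicalPhysics.QuantumFieldTheory.King1986.Torus (blockOf tdistT tdistT_nonneg tdistT_self)
open Summit.QuantumFields.YangMills.BalabanUVNodes.N15.MatrixSpecies (mmulOp liftMap liftBlk liftEquiv liftEquiv_apply liftEquiv_symm_apply basisConst basisConst_nonneg covD)
open Summit.QuantumFields.YangMills.BalabanUVNodes.N15.TwoGrid (gOp symbOp sT sTinv sD sLap paramsOf hasMaj_rate_mono hasMaj_twoGridDefect_div TGIndex TGIndex.Mn)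
open Summit.QuantumFields.YangMills.BalabanUVNodes.N15.VectorPiece (blkFine kingPrV blkFine_comp_kingPrV bshiftEquiv bshiftEquiv_apply bshiftEquiv_symm_apply bshiftV bshiftV_apply
  tensorId tensorId_apply hasMaj_tensorId idef_tensorId kingPrV_bshiftEquiv_pow fibre_conn_kingPrV bshiftEquiv_comm inv_pow_le_rpow)

variable {d : ℕ} {L : ℕ} [NeZero L]

/-! ## §1 The reading bridge and the window-level composition: in FILE 32's regularity window the family's entries 1 and 3 ARE `𝔇(∇_{U′,ν}X′, ∇_{U,ν}X)` and `𝔇(Δ_{U′}X′, Δ_U X)` -/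

section Window

open Summit.QuantumFields.YangMills.BalabanUVNodes.N15.OperatorReadout (opFamily)

variable (d) (𝔄 : Type) [NormedRing 𝔄] [NormedAlgebra ℝ 𝔄] [CompleteSpace 𝔄] (ι : Type) [Fintype ι] [DecidableEq ι] [Nonempty ι] (e : 𝔄 ≃L[ℝ] (ι → ℝ))

omit [NeZero L] [CompleteSpace 𝔄] [Nonempty ι] in
/-- Entry `1` of FILE 34's covariant operator four-tuple is the η-difference of the fine and coarse `covEntry1`'s (unfolding, `rfl`). [bookkeeping] -/
theorem bgOpsM₂RC_one {X X' J Cfg : Type} [Fintype X] [Fintype X'] [DecidableEq X] [DecidableEq X'] [Fintype J] [DecidableEq J]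
    (cfgF : Cfg → (X' → Matrix ι ι ℝ) × (J ⊕ J → X' → Matrix ι ι ℝ)) (cfgC : Cfg → (X → Matrix ι ι ℝ) × (J ⊕ J → X → Matrix ι ι ℝ)) (π : X' → X)
    (τ : J → X ≃ X) (τ' : J → X' ≃ X') (n n' : ℝ) (ν : J) (G D₃ : (X × ι → ℝ) →ₗ[ℝ] (X × ι → ℝ)) (D : J ⊕ J → (X × ι → ℝ) →ₗ[ℝ] (X × ι → ℝ))
    (G' D₃' : (X' × ι → ℝ) →ₗ[ℝ] (X' × ι → ℝ)) (D' : J ⊕ J → (X' × ι → ℝ) →ₗ[ℝ] (X' × ι → ℝ)) (U : Cfg) :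
    bgOpsM₂RC J ι cfgF cfgC π τ τ' n n' ν G D₃ D G' D₃' D' 1 U =
      idef (pull (liftMap π ι)) (pull (liftMap π ι)) (covEntry1 n'⁻¹ G' D' (cfgF U).1 (cfgF U).2 ν) (covEntry1 n⁻¹ G D (cfgC U).1 (cfgC U).2 ν) := rfl

omit [NeZero L] [CompleteSpace 𝔄] [Nonempty ι] in
/-- Entry `3` of FILE 34's covariant operator four-tuple is the η-difference of the fine and coarse `covEntry3`'s (unfolding, `rfl`). [bookkeeping] -/
theorem bgOpsM₂RC_three {X X' J Cfg : Type} [Fintype X] [Fintype X'] [DecidableEq X] [DecidableEq X'] [Fintype J] [DecidableEq J]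
    (cfgF : Cfg → (X' → Matrix ι ι ℝ) × (J ⊕ J → X' → Matrix ι ι ℝ)) (cfgC : Cfg → (X → Matrix ι ι ℝ) × (J ⊕ J → X → Matrix ι ι ℝ)) (π : X' → X)
    (τ : J → X ≃ X) (τ' : J → X' ≃ X') (n n' : ℝ) (ν : J) (G D₃ : (X × ι → ℝ) →ₗ[ℝ] (X × ι → ℝ)) (D : J ⊕ J → (X × ι → ℝ) →ₗ[ℝ] (X × ι → ℝ))
    (G' D₃' : (X' × ι → ℝ) →ₗ[ℝ] (X' × ι → ℝ)) (D' : J ⊕ J → (X' × ι → ℝ) →ₗ[ℝ] (X' × ι → ℝ)) (U : Cfg) :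
    bgOpsM₂RC J ι cfgF cfgC π τ τ' n n' ν G D₃ D G' D₃' D' 3 U =
      idef (pull (liftMap π ι)) (pull (liftMap π ι)) (covEntry3 G' D₃' D' (cfgF U).1 (cfgF U).2) (covEntry3 G D₃ D (cfgC U).1 (cfgC U).2) := rfl

omit [CompleteSpace 𝔄] [Nonempty ι] in
/-- **THE READING BRIDGE**: `fgFamilyV1XC … i` IS n15-b's kernel readout `opFamily` of FILE 34's covariant operator four-tuple `bgOpsM₂RC` at the exact readings, pieces and spacings of the
index (unfolding FILE 34 `bgFamilyM₂RC`, `rfl`) — so the family's (3.42) entries 1 ∕ 3 at a configuration `A′` are the kernels of the operators identified below. [bookkeeping] -/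
theorem fgFamilyV1XC_eq_opFamily (hL : Odd L ∧ 1 < L) (b : ℝ) (i : TGIndex × Fin (d + 1)) :
    fgFamilyV1XC d 𝔄 ι e hL b i =
      opFamily (g := unitTorusGeo L i.1.k (TGIndex.Mn d hL i.1)) (B := (fgInstanceV1G d 𝔄 ι hL i).Bf) (liftBlk (blkFine L i.1.k (TGIndex.Mn d hL i.1)) ι)
        (liftBlk (blkFine L i.1.k (TGIndex.Mn d hL i.1) ∘ kingPrV L i.1.k i.1.m (TGIndex.Mn d hL i.1)) ι)
        (bgOpsM₂RC (Fin (d + 1)) ι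
          (v1cfgFX 𝔄 ι e (fun μ => bshiftEquiv (TGIndex.Mn d hL i.1) (L ^ i.1.m * L ^ i.1.k) μ)
            ((unitTorusGeo L i.1.k (TGIndex.Mn d hL i.1)).eta * ((unitTorusGeo L i.1.k (TGIndex.Mn d hL i.1)).L ^ i.1.m)⁻¹))
          (v1cfgCX 𝔄 ι e (kingPrV L i.1.k i.1.m (TGIndex.Mn d hL i.1)) (fun μ => bshiftEquiv (TGIndex.Mn d hL i.1) (L ^ i.1.k) μ) (unitTorusGeo L i.1.k (TGIndex.Mn d hL i.1)).eta)
          (kingPrV L i.1.k i.1.m (TGIndex.Mn d hL i.1)) (fun μ => bshiftEquiv (TGIndex.Mn d hL i.1) (L ^ i.1.k) μ) (fun μ => bshiftEquiv (TGIndex.Mn d hL i.1) (L ^ i.1.m * L ^ i.1.k) μ)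
          ((L ^ i.1.k : ℕ) : ℝ) ((L ^ i.1.m * L ^ i.1.k : ℕ) : ℝ) i.2
          (tensorId ι (gOp (TGIndex.Mn d hL i.1) (L ^ i.1.k) b))
          (tensorId ι (symbOp (TGIndex.Mn d hL i.1) (L ^ i.1.k) (sLap (TGIndex.Mn d hL i.1) (L ^ i.1.k) ((L ^ i.1.k : ℕ) : ℝ)) ∘ₗ gOp (TGIndex.Mn d hL i.1) (L ^ i.1.k) b))
          (dPiecesM₂ d ι (TGIndex.Mn d hL i.1) (L ^ i.1.k) b)
          (tensorId ι (gOp (TGIndex.Mn d hL i.1) (L ^ i.1.m * L ^ i.1.k) b))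
          (tensorId ι (symbOp (TGIndex.Mn d hL i.1) (L ^ i.1.m * L ^ i.1.k) (sLap (TGIndex.Mn d hL i.1) (L ^ i.1.m * L ^ i.1.k) ((L ^ i.1.m * L ^ i.1.k : ℕ) : ℝ)) ∘ₗ
            gOp (TGIndex.Mn d hL i.1) (L ^ i.1.m * L ^ i.1.k) b))
          (dPiecesM₂ d ι (TGIndex.Mn d hL i.1) (L ^ i.1.m * L ^ i.1.k) b)) := rfl

/-- ★★★ **THE IDENTIFICATION IN THE WINDOW** (what FILE 35 §3 gives once FILE 32's hypothesis-free Neumann-unit window ★★ `isUnit_neumann_torus_window` is applied — no unit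
hypothesis left): for odd `L ≥ 3`, `b > 0`, `c₃₅ > 0` there is `a₀ > 0` such that for EVERY index `i = ((m_T, k, m), ν)`, every `α₀ > 0` with `Mα₀ ≤ a₀` (here `M = 1`) and every gauge field `A′` on
the fine torus regular at `(c₃₅, α₀)` ((3.35), C² reading), ENTRY 1 of the covariant operator four-tuple behind `fgFamilyV1XC … i` (`fgFamilyV1XC_eq_opFamily`) at `A′` IS
`𝔇(∇_{exp(η′ ad A′_ν), τ′_ν} ∘ X′(A′), ∇_{exp(η ad Ā_ν), τ_ν} ∘ X(Ā))` — n15-b's covariant derivative `covD` of the fine ∕ coarse dressed propagators, `Ā = gavgM π A′` the block mean,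
`η′ = (L^mL^k)⁻¹`, `η = (L^k)⁻¹` — and ENTRY 3 IS `𝔇(Δ_{exp(η′ ad A′)} ∘ X′(A′), Δ_{exp(η ad Ā)} ∘ X(Ā))` (FILE 28 `covLapM`).  Proof: FILE 35 §3's two per-lattice theorems at both lattices,
their `hunit` supplied by `isUnit_neumann_torus_window`; the spacings `(unitTorusGeo …).eta·(L^m)⁻¹ = ((L^mL^k : ℕ) : ℝ)⁻¹`, `(unitTorusGeo …).eta = ((L^k : ℕ) : ℝ)⁻¹` by `push_cast`.
[cite: Balaban1985BackgroundPropagators, Thm 3.1 (3.42) p.397 (entries «∇_U G(U)λ», «Δ_U G(U)λ») + (3.50)–(3.53) p.400 + (3.35) p.396 (the window)] -/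
theorem covEntries_torus_eq (hLodd : Odd L) (hL2 : 2 ≤ L) (hL : Odd L ∧ 1 < L) {b : ℝ} (hb : 0 < b) {c35 : ℝ} (hc35 : 0 < c35) :
    ∃ a₀ : ℝ, 0 < a₀ ∧ ∀ (i : TGIndex × Fin (d + 1)) (α₀ : ℝ), 0 < α₀ → (unitTorusGeo L i.1.k (TGIndex.Mn d hL i.1)).M * α₀ ≤ a₀ →
      ∀ A' : Fin (d + 1) → Tor (fine (L ^ i.1.m * L ^ i.1.k) (TGIndex.Mn d hL i.1)) × Fin (d + 1) → 𝔄,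
        (v1GaugeBg 𝔄 (Fin (d + 1)) (fun μ => bshiftEquiv (TGIndex.Mn d hL i.1) (L ^ i.1.m * L ^ i.1.k) μ)
            ((unitTorusGeo L i.1.k (TGIndex.Mn d hL i.1)).eta * ((unitTorusGeo L i.1.k (TGIndex.Mn d hL i.1)).L ^ i.1.m)⁻¹) (unitTorusGeo L i.1.k (TGIndex.Mn d hL i.1)).M).Reg335 c35 α₀ A' →
        bgOpsM₂RC (Fin (d + 1)) ι
            (v1cfgFX 𝔄 ι e (fun μ => bshiftEquiv (TGIndex.Mn d hL i.1) (L ^ i.1.m * L ^ i.1.k) μ)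
              ((unitTorusGeo L i.1.k (TGIndex.Mn d hL i.1)).eta * ((unitTorusGeo L i.1.k (TGIndex.Mn d hL i.1)).L ^ i.1.m)⁻¹))
            (v1cfgCX 𝔄 ι e (kingPrV L i.1.k i.1.m (TGIndex.Mn d hL i.1)) (fun μ => bshiftEquiv (TGIndex.Mn d hL i.1) (L ^ i.1.k) μ) (unitTorusGeo L i.1.k (TGIndex.Mn d hL i.1)).eta)
            (kingPrV L i.1.k i.1.m (TGIndex.Mn d hL i.1)) (fun μ => bshiftEquiv (TGIndex.Mn d hL i.1) (L ^ i.1.k) μ) (fun μ => bshiftEquiv (TGIndex.Mn d hL i.1) (L ^ i.1.m * L ^ i.1.k) μ)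
            ((L ^ i.1.k : ℕ) : ℝ) ((L ^ i.1.m * L ^ i.1.k : ℕ) : ℝ) i.2
            (tensorId ι (gOp (TGIndex.Mn d hL i.1) (L ^ i.1.k) b))
            (tensorId ι (symbOp (TGIndex.Mn d hL i.1) (L ^ i.1.k) (sLap (TGIndex.Mn d hL i.1) (L ^ i.1.k) ((L ^ i.1.k : ℕ) : ℝ)) ∘ₗ gOp (TGIndex.Mn d hL i.1) (L ^ i.1.k) b))
            (dPiecesM₂ d ι (TGIndex.Mn d hL i.1) (L ^ i.1.k) b)
            (tensorId ι (gOp (TGIndex.Mn d hL i.1) (L ^ i.1.m * L ^ i.1.k) b))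
            (tensorId ι (symbOp (TGIndex.Mn d hL i.1) (L ^ i.1.m * L ^ i.1.k) (sLap (TGIndex.Mn d hL i.1) (L ^ i.1.m * L ^ i.1.k) ((L ^ i.1.m * L ^ i.1.k : ℕ) : ℝ)) ∘ₗ
              gOp (TGIndex.Mn d hL i.1) (L ^ i.1.m * L ^ i.1.k) b))
            (dPiecesM₂ d ι (TGIndex.Mn d hL i.1) (L ^ i.1.m * L ^ i.1.k) b) 1 A' =
          idef (pull (liftMap (kingPrV L i.1.k i.1.m (TGIndex.Mn d hL i.1)) ι)) (pull (liftMap (kingPrV L i.1.k i.1.m (TGIndex.Mn d hL i.1)) ι))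
            (covD (((L ^ i.1.m * L ^ i.1.k : ℕ) : ℝ))⁻¹
                (gaugeTransport e (bshiftEquiv (TGIndex.Mn d hL i.1) (L ^ i.1.m * L ^ i.1.k)) (((L ^ i.1.m * L ^ i.1.k : ℕ) : ℝ))⁻¹ A' (Sum.inl i.2))
                (bshiftEquiv (TGIndex.Mn d hL i.1) (L ^ i.1.m * L ^ i.1.k) i.2) ∘ₗ
              (projO none ∘ₗ bgPairM (tensorId ι (gOp (TGIndex.Mn d hL i.1) (L ^ i.1.m * L ^ i.1.k) b)) (dPiecesM₂ d ι (TGIndex.Mn d hL i.1) (L ^ i.1.m * L ^ i.1.k) b)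
                (v1coefCX e (((L ^ i.1.m * L ^ i.1.k : ℕ) : ℝ))⁻¹
                  (v1fieldsOfGauge 𝔄 (Fin (d + 1)) (bshiftEquiv (TGIndex.Mn d hL i.1) (L ^ i.1.m * L ^ i.1.k)) (((L ^ i.1.m * L ^ i.1.k : ℕ) : ℝ))⁻¹ A'))
                (v1coefAX e (((L ^ i.1.m * L ^ i.1.k : ℕ) : ℝ))⁻¹
                  (v1fieldsOfGauge 𝔄 (Fin (d + 1)) (bshiftEquiv (TGIndex.Mn d hL i.1) (L ^ i.1.m * L ^ i.1.k)) (((L ^ i.1.m * L ^ i.1.k : ℕ) : ℝ))⁻¹ A'))))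
            (covD (((L ^ i.1.k : ℕ) : ℝ))⁻¹
                (gaugeTransport e (bshiftEquiv (TGIndex.Mn d hL i.1) (L ^ i.1.k)) (((L ^ i.1.k : ℕ) : ℝ))⁻¹
                  (gavgM 𝔄 (Fin (d + 1)) (kingPrV L i.1.k i.1.m (TGIndex.Mn d hL i.1)) A') (Sum.inl i.2))
                (bshiftEquiv (TGIndex.Mn d hL i.1) (L ^ i.1.k) i.2) ∘ₗ
              (projO none ∘ₗ bgPairM (tensorId ι (gOp (TGIndex.Mn d hL i.1) (L ^ i.1.k) b)) (dPiecesM₂ d ι (TGIndex.Mn d hL i.1) (L ^ i.1.k) b)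
                (v1coefCX e (((L ^ i.1.k : ℕ) : ℝ))⁻¹
                  (v1fieldsOfGauge 𝔄 (Fin (d + 1)) (bshiftEquiv (TGIndex.Mn d hL i.1) (L ^ i.1.k)) (((L ^ i.1.k : ℕ) : ℝ))⁻¹
                    (gavgM 𝔄 (Fin (d + 1)) (kingPrV L i.1.k i.1.m (TGIndex.Mn d hL i.1)) A')))
                (v1coefAX e (((L ^ i.1.k : ℕ) : ℝ))⁻¹
                  (v1fieldsOfGauge 𝔄 (Fin (d + 1)) (bshiftEquiv (TGIndex.Mn d hL i.1) (L ^ i.1.k)) (((L ^ i.1.k : ℕ) : ℝ))⁻¹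
                    (gavgM 𝔄 (Fin (d + 1)) (kingPrV L i.1.k i.1.m (TGIndex.Mn d hL i.1)) A'))))) ∧
        bgOpsM₂RC (Fin (d + 1)) ι
            (v1cfgFX 𝔄 ι e (fun μ => bshiftEquiv (TGIndex.Mn d hL i.1) (L ^ i.1.m * L ^ i.1.k) μ)
              ((unitTorusGeo L i.1.k (TGIndex.Mn d hL i.1)).eta * ((unitTorusGeo L i.1.k (TGIndex.Mn d hL i.1)).L ^ i.1.m)⁻¹))
            (v1cfgCX 𝔄 ι e (kingPrV L i.1.k i.1.m (TGIndex.Mn d hL i.1)) (fun μ => bshiftEquiv (TGIndex.Mn d hL i.1) (L ^ i.1.k) μ) (unitTorusGeo L i.1.k (TGIndex.Mn d hL i.1)).eta)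
            (kingPrV L i.1.k i.1.m (TGIndex.Mn d hL i.1)) (fun μ => bshiftEquiv (TGIndex.Mn d hL i.1) (L ^ i.1.k) μ) (fun μ => bshiftEquiv (TGIndex.Mn d hL i.1) (L ^ i.1.m * L ^ i.1.k) μ)
            ((L ^ i.1.k : ℕ) : ℝ) ((L ^ i.1.m * L ^ i.1.k : ℕ) : ℝ) i.2
            (tensorId ι (gOp (TGIndex.Mn d hL i.1) (L ^ i.1.k) b))
            (tensorId ι (symbOp (TGIndex.Mn d hL i.1) (L ^ i.1.k) (sLap (TGIndex.Mn d hL i.1) (L ^ i.1.k) ((L ^ i.1.k : ℕ) : ℝ)) ∘ₗ gOp (TGIndex.Mn d hL i.1) (L ^ i.1.k) b))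
            (dPiecesM₂ d ι (TGIndex.Mn d hL i.1) (L ^ i.1.k) b)
            (tensorId ι (gOp (TGIndex.Mn d hL i.1) (L ^ i.1.m * L ^ i.1.k) b))
            (tensorId ι (symbOp (TGIndex.Mn d hL i.1) (L ^ i.1.m * L ^ i.1.k) (sLap (TGIndex.Mn d hL i.1) (L ^ i.1.m * L ^ i.1.k) ((L ^ i.1.m * L ^ i.1.k : ℕ) : ℝ)) ∘ₗ
              gOp (TGIndex.Mn d hL i.1) (L ^ i.1.m * L ^ i.1.k) b))
            (dPiecesM₂ d ι (TGIndex.Mn d hL i.1) (L ^ i.1.m * L ^ i.1.k) b) 3 A' =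
          idef (pull (liftMap (kingPrV L i.1.k i.1.m (TGIndex.Mn d hL i.1)) ι)) (pull (liftMap (kingPrV L i.1.k i.1.m (TGIndex.Mn d hL i.1)) ι))
            (covLapM (bshiftEquiv (TGIndex.Mn d hL i.1) (L ^ i.1.m * L ^ i.1.k)) (((L ^ i.1.m * L ^ i.1.k : ℕ) : ℝ))⁻¹
                (gaugeTransport e (bshiftEquiv (TGIndex.Mn d hL i.1) (L ^ i.1.m * L ^ i.1.k)) (((L ^ i.1.m * L ^ i.1.k : ℕ) : ℝ))⁻¹ A') ∘ₗ
              (projO none ∘ₗ bgPairM (tensorId ι (gOp (TGIndex.Mn d hL i.1) (L ^ i.1.m * L ^ i.1.k) b)) (dPiecesM₂ d ι (TGIndex.Mn d hL i.1) (L ^ i.1.m * L ^ i.1.k) b)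
                (v1coefCX e (((L ^ i.1.m * L ^ i.1.k : ℕ) : ℝ))⁻¹
                  (v1fieldsOfGauge 𝔄 (Fin (d + 1)) (bshiftEquiv (TGIndex.Mn d hL i.1) (L ^ i.1.m * L ^ i.1.k)) (((L ^ i.1.m * L ^ i.1.k : ℕ) : ℝ))⁻¹ A'))
                (v1coefAX e (((L ^ i.1.m * L ^ i.1.k : ℕ) : ℝ))⁻¹
                  (v1fieldsOfGauge 𝔄 (Fin (d + 1)) (bshiftEquiv (TGIndex.Mn d hL i.1) (L ^ i.1.m * L ^ i.1.k)) (((L ^ i.1.m * L ^ i.1.k : ℕ) : ℝ))⁻¹ A'))))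
            (covLapM (bshiftEquiv (TGIndex.Mn d hL i.1) (L ^ i.1.k)) (((L ^ i.1.k : ℕ) : ℝ))⁻¹
                (gaugeTransport e (bshiftEquiv (TGIndex.Mn d hL i.1) (L ^ i.1.k)) (((L ^ i.1.k : ℕ) : ℝ))⁻¹
                  (gavgM 𝔄 (Fin (d + 1)) (kingPrV L i.1.k i.1.m (TGIndex.Mn d hL i.1)) A')) ∘ₗ
              (projO none ∘ₗ bgPairM (tensorId ι (gOp (TGIndex.Mn d hL i.1) (L ^ i.1.k) b)) (dPiecesM₂ d ι (TGIndex.Mn d hL i.1) (L ^ i.1.k) b)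
                (v1coefCX e (((L ^ i.1.k : ℕ) : ℝ))⁻¹
                  (v1fieldsOfGauge 𝔄 (Fin (d + 1)) (bshiftEquiv (TGIndex.Mn d hL i.1) (L ^ i.1.k)) (((L ^ i.1.k : ℕ) : ℝ))⁻¹
                    (gavgM 𝔄 (Fin (d + 1)) (kingPrV L i.1.k i.1.m (TGIndex.Mn d hL i.1)) A')))
                (v1coefAX e (((L ^ i.1.k : ℕ) : ℝ))⁻¹
                  (v1fieldsOfGauge 𝔄 (Fin (d + 1)) (bshiftEquiv (TGIndex.Mn d hL i.1) (L ^ i.1.k)) (((L ^ i.1.k : ℕ) : ℝ))⁻¹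
                    (gavgM 𝔄 (Fin (d + 1)) (kingPrV L i.1.k i.1.m (TGIndex.Mn d hL i.1)) A'))))) := by
  obtain ⟨a₀, ha₀, W⟩ := isUnit_neumann_torus_window d 𝔄 ι e hLodd hL2 hL hb hc35
  refine ⟨a₀, ha₀, fun i α₀ hα₀ hαa A' hA => ?_⟩
  obtain ⟨hF, hC⟩ := W i α₀ hα₀ hαa A' hA
  have h1 : (unitTorusGeo L i.1.k (TGIndex.Mn d hL i.1)).eta = ((L : ℝ) ^ i.1.k)⁻¹ := rfl
  have h2 : (unitTorusGeo L i.1.k (TGIndex.Mn d hL i.1)).L = (L : ℝ) := rfl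
  have hηf : (unitTorusGeo L i.1.k (TGIndex.Mn d hL i.1)).eta * ((unitTorusGeo L i.1.k (TGIndex.Mn d hL i.1)).L ^ i.1.m)⁻¹ = (((L ^ i.1.m * L ^ i.1.k : ℕ) : ℝ))⁻¹ := by
    rw [h1, h2, ← mul_inv, mul_comm]; push_cast; rfl
  have hηc : (unitTorusGeo L i.1.k (TGIndex.Mn d hL i.1)).eta = (((L ^ i.1.k : ℕ) : ℝ))⁻¹ := by rw [h1]; push_cast; rfl
  rw [bgOpsM₂RC_one, bgOpsM₂RC_three, hηf, hηc]
  rw [hηf] at hF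
  rw [hηc] at hC
  exact ⟨(congrArg₂ (idef _ _) (covD_dressed_eq_covEntry1_torus d ι e _ _ A' i.2 hF)
      (covD_dressed_eq_covEntry1_torus d ι e _ _ (gavgM 𝔄 (Fin (d + 1)) (kingPrV L i.1.k i.1.m (TGIndex.Mn d hL i.1)) A') i.2 hC)).symm,
    (congrArg₂ (idef _ _) (covLapM_dressed_eq_covEntry3_torus d ι e _ _ A' hF)
      (covLapM_dressed_eq_covEntry3_torus d ι e _ _ (gavgM 𝔄 (Fin (d + 1)) (kingPrV L i.1.k i.1.m (TGIndex.Mn d hL i.1)) A') hC)).symm⟩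

end Window

end Summit.QuantumFields.YangMills.BalabanUVNodes.N15.BackgroundLayer
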